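import Mathlib
import Summits.Ventures.PercRepro.PuncturedLYMSplit

/-!
# PercRepro — THE PEELING COMPOSITION LEMMA: A FLOW OF A STAGE FROM THE FLOWS OF ITS INNER INSTANCES
(p10, gen 42)

A ground set `C ∪ W` (`C`, `W` disjoint; `C` is the coordinate being PEELED — a member of size `m`, or the free part), a level
`l`, and for every inner level an inner row family `P' t ⊆ C(W, t)`.  The STAGE ROWS are the `l`-subsets `X` of `C ∪ W` that
do not contain `C` and whose `W`-part lies in the inner family at level `l − #(X ∩ C)`.  Given a flow `w' s` of every inner
instance `(W, l − s, P' (l − s))` (row sums `ρ' s`, column sums `ν' s`) and nonnegative `C`-REMOVAL weights `g t Y'` (the weight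
a column with `t` points in `C` and `W`-part `Y'` gives to each of its `t` rows obtained by removing a point of `C`), the
composed weight

  `peelWeight X Y = w' #(X ∩ C) (X ∩ W) (Y ∩ W)` if the added point lies in `W`, `= g #(Y ∩ C) (Y ∩ W)` if it lies in `C`

is a flow of the stage with row sums `(#C − #(X ∩ C))·g (#(X ∩ C) + 1) (X ∩ W) + ρ' #(X ∩ C) (X ∩ W)` and column sums
`[Y ∩ W ∈ P' (l + 1 − t)]·t·g t (Y ∩ W) + [t < #C ∧ t ≤ l]·ν' t (Y ∩ W)`, `t = #(Y ∩ C)` (`hasFlow_peel`).  This is the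
composition step of the SEQUENTIAL PEELING FLOW (paper proofs/P10-PEEL-g42.md §1): with constant inner row sums and the
`C`-removal weights `a(1 − A(t))/t` it gives the flow of (SP)_a from the flows of (SP)_{a·A(t)} on the inner world, the
numbers `A(t)` being the solutions of the triangular row equations.  Nothing here asserts (SP).
-/

namespace PercRepro.PuncturedLYM.Split.Peel

open Finset

variable {α : Type} [DecidableEq α]

/-! ### The stage rows and the composed weight -/

/-- The rows of the stage: the `l`-subsets of `C ∪ W` not containing `C` whose `W`-part is an inner row at the level
`l − #(X ∩ C)`. -/
def stageRows (C W : Finset α) (l : ℕ) (P' : ℕ → Finset (Finset α)) : Finset (Finset α) :=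
  ((C ∪ W).powersetCard l).filter (fun X => ¬ C ⊆ X ∧ X ∩ W ∈ P' (l - (X ∩ C).card))

/-- The composed weight: the inner weight when the two sets have the same `C`-part (the added point lies in `W`), the
`C`-removal weight of the column otherwise. -/
def peelWeight (C W : Finset α) (g : ℕ → Finset α → ℚ) (w' : ℕ → Finset α → Finset α → ℚ)
    (X Y : Finset α) : ℚ :=
  if Y ∩ C = X ∩ C then w' (X ∩ C).card (X ∩ W) (Y ∩ W) else g (Y ∩ C).card (Y ∩ W)

/-- Membership in the stage rows. -/
theorem mem_stageRows {C W X : Finset α} {l : ℕ} {P' : ℕ → Finset (Finset α)} :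
    X ∈ stageRows C W l P' ↔ X ⊆ C ∪ W ∧ X.card = l ∧ ¬ C ⊆ X ∧ X ∩ W ∈ P' (l - (X ∩ C).card) := by
  simp only [stageRows, mem_filter, mem_powersetCard, and_assoc]

/-! ### Sums over the rows below a column are sums over the removed point -/

/-- `erase` is injective on `Y`. -/
theorem erase_injOn (Y : Finset α) : Set.InjOn (fun y => Y.erase y) (Y : Set α) := by
  intro y hy z hz h
  simp only at h
  by_contra hyz
  have : y ∈ Y.erase z := mem_erase.2 ⟨hyz, hy⟩
  rw [← h] at this
  exact (notMem_erase y Y) this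

/-- A subset of `Y` with one element less is `Y` minus a point. -/
theorem eq_erase_of_subset_of_card {X Y : Finset α} (hXY : X ⊆ Y) (hc : X.card + 1 = Y.card) :
    ∃ y ∈ Y, X = Y.erase y := by
  have h1 : (Y \ X).card = 1 := by
    rw [card_sdiff_of_subset hXY]; omega
  obtain ⟨y, hy⟩ := card_eq_one.1 h1
  have hyY : y ∈ Y := (mem_sdiff.1 (hy ▸ mem_singleton_self y)).1
  refine ⟨y, hyY, ?_⟩
  ext z
  constructor
  · intro hz
    refine mem_erase.2 ⟨?_, hXY hz⟩
    rintro rfl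
    exact (mem_sdiff.1 (hy ▸ mem_singleton_self z)).2 hz
  · intro hz
    obtain ⟨hzy, hzY⟩ := mem_erase.1 hz
    by_contra hzX
    have : z ∈ Y \ X := mem_sdiff.2 ⟨hzY, hzX⟩
    rw [hy, mem_singleton] at this
    exact hzy this

/-- The rows of a family of `l`-sets below an `(l+1)`-set `Y` are the `Y ∖ y`, `y ∈ Y`, that are rows. -/
theorem sum_subs_eq {P : Finset (Finset α)} {Y : Finset α} {l : ℕ} (hP : ∀ X ∈ P, X.card = l)
    (hY : Y.card = l + 1) (f : Finset α → ℚ) :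
    ∑ X ∈ subs P Y, f X = ∑ y ∈ Y.filter (fun y => Y.erase y ∈ P), f (Y.erase y) := by
  have himg : subs P Y = (Y.filter (fun y => Y.erase y ∈ P)).image (fun y => Y.erase y) := by
    ext X
    rw [mem_subs, mem_image]
    constructor
    · rintro ⟨hXP, hXY⟩
      obtain ⟨y, hyY, rfl⟩ := eq_erase_of_subset_of_card hXY (by rw [hP _ hXP, hY])
      exact ⟨y, mem_filter.2 ⟨hyY, hXP⟩, rfl⟩
    · rintro ⟨y, hy, rfl⟩
      exact ⟨(mem_filter.1 hy).2, erase_subset y Y⟩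
  rw [himg]
  exact sum_image ((erase_injOn Y).mono (by intro y hy; exact (mem_filter.1 hy).1))

/-! ### The composition lemma -/

/-- **THE PEELING COMPOSITION LEMMA.** `C`, `W` disjoint; inner row families `P' t ⊆ C(W, t)`; for every `s ≤ l` with
`s < #C` a flow `w' s` of the inner instance `(W, l − s, P' (l − s), ρ' s, ν' s)`, all `w'` nonnegative; nonnegative
`C`-removal weights `g`.  Then `peelWeight` is a flow of the stage `(C ∪ W, l, stageRows)` with row sums
`(#C − #(X ∩ C))·g (#(X ∩ C) + 1) (X ∩ W) + ρ' #(X ∩ C) (X ∩ W)` and column sums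
`[Y ∩ W ∈ P' (l + 1 − t)]·t·g t (Y ∩ W) + [t < #C ∧ t ≤ l]·ν' t (Y ∩ W)`, `t = #(Y ∩ C)`. -/
theorem isFlow_peel {C W : Finset α} (hCW : Disjoint C W) {l : ℕ} {P' : ℕ → Finset (Finset α)}
    (hP' : ∀ t, P' t ⊆ W.powersetCard t)
    {ρ' ν' : ℕ → Finset α → ℚ} {w' : ℕ → Finset α → Finset α → ℚ}
    (hw'nn : ∀ s X Y, 0 ≤ w' s X Y)
    (hflow : ∀ s, s ≤ l → s < C.card → IsFlow W (l - s) (P' (l - s)) (ρ' s) (ν' s) (w' s))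
    {g : ℕ → Finset α → ℚ} (hg : ∀ t Y, 0 ≤ g t Y) :
    IsFlow (C ∪ W) l (stageRows C W l P')
      (fun X => ((C.card : ℚ) - (X ∩ C).card) * g ((X ∩ C).card + 1) (X ∩ W) + ρ' (X ∩ C).card (X ∩ W))
      (fun Y => (if Y ∩ W ∈ P' (l + 1 - (Y ∩ C).card) then ((Y ∩ C).card : ℚ) * g (Y ∩ C).card (Y ∩ W) else 0)
        + (if (Y ∩ C).card < C.card ∧ (Y ∩ C).card ≤ l then ν' (Y ∩ C).card (Y ∩ W) else 0))
      (peelWeight C W g w') := by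
  refine ⟨?_, ?_, ?_⟩
  · -- nonnegativity
    intro X Y
    unfold peelWeight
    split_ifs
    · exact hw'nn _ _ _
    · exact hg _ _
  · -- row sums
    intro X hX
    obtain ⟨hXS, hXc, hCX, hXW⟩ := mem_stageRows.1 hX
    have hsC : (X ∩ C).card < C.card := by
      by_contra h
      have h' : C.card ≤ (X ∩ C).card := not_lt.1 h
      exact hCX (by
        have : X ∩ C = C := eq_of_subset_of_card_le inter_subset_right h'
        rw [← this]; exact inter_subset_left)
    have hsl : (X ∩ C).card ≤ l := by rw [← hXc]; exact card_le_card inter_subset_left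
    rw [sum_sups, union_sdiff_distrib, sum_union (hCW.mono sdiff_subset sdiff_subset)]
    -- the `C`-additions
    have hC : ∑ y ∈ C \ X, peelWeight C W g w' X (insert y X)
        = ((C.card : ℚ) - (X ∩ C).card) * g ((X ∩ C).card + 1) (X ∩ W) := by
      have hterm : ∀ y ∈ C \ X, peelWeight C W g w' X (insert y X) = g ((X ∩ C).card + 1) (X ∩ W) := by
        intro y hy
        obtain ⟨hyC, hyX⟩ := mem_sdiff.1 hy
        have hyW : y ∉ W := fun hyW => (Finset.disjoint_left.1 hCW) hyC hyW
        have h1 : insert y X ∩ C = insert y (X ∩ C) := insert_inter_of_mem hyC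
        have h2 : insert y X ∩ W = X ∩ W := insert_inter_of_notMem hyW
        have hne : insert y X ∩ C ≠ X ∩ C := by
          rw [h1]; intro h
          have : y ∈ X ∩ C := h ▸ mem_insert_self y (X ∩ C)
          exact hyX (mem_inter.1 this).1
        have hyXC : y ∉ X ∩ C := fun h => hyX (mem_inter.1 h).1
        unfold peelWeight
        rw [if_neg hne, h1, h2, card_insert_of_notMem hyXC]
      rw [sum_congr rfl hterm, sum_const, nsmul_eq_mul]
      congr 1
      have hcard := card_sdiff_add_card_inter C X
      rw [inter_comm] at hcard
      have : ((C \ X).card : ℚ) = C.card - (X ∩ C).card := by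
        have h := congrArg (fun n : ℕ => (n : ℚ)) hcard
        push_cast at h
        linarith
      exact this
    -- the `W`-additions
    have hW : ∑ y ∈ W \ X, peelWeight C W g w' X (insert y X) = ρ' (X ∩ C).card (X ∩ W) := by
      have hrow := (hflow _ hsl hsC).row (X ∩ W) hXW
      rw [sum_sups] at hrow
      have hset : W \ X = W \ (X ∩ W) := by
        ext y; simp only [mem_sdiff, mem_inter]; tauto
      rw [hset, ← hrow]
      apply sum_congr rfl
      intro y hy
      obtain ⟨hyW, hyXW⟩ := mem_sdiff.1 hy
      have hyC : y ∉ C := fun hyC => (Finset.disjoint_left.1 hCW) hyC hyW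
      have h1 : insert y X ∩ C = X ∩ C := insert_inter_of_notMem hyC
      have h2 : insert y X ∩ W = insert y (X ∩ W) := insert_inter_of_mem hyW
      simp only [peelWeight, if_pos h1, h2]
    rw [hC, hW]
  · -- column sums
    intro Y hY
    obtain ⟨hYS, hYc⟩ := mem_cols.1 hY
    have hrows : ∀ X ∈ stageRows C W l P', X.card = l := fun X hX => (mem_stageRows.1 hX).2.1
    rw [sum_subs_eq hrows hYc]
    have hYsplit : Y = Y ∩ C ∪ Y ∩ W := by
      rw [← inter_union_distrib_left, inter_eq_left.2 hYS]
    have hdisj : Disjoint (Y ∩ C) (Y ∩ W) := hCW.mono inter_subset_right inter_subset_right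
    rw [hYsplit, filter_union, sum_union (disjoint_filter_filter hdisj)]
    rw [← hYsplit]
    have htl : (Y ∩ C).card ≤ l + 1 := by rw [← hYc]; exact card_le_card inter_subset_left
    -- the rows obtained by removing a point of `C`
    have hC : ∑ y ∈ (Y ∩ C).filter (fun y => Y.erase y ∈ stageRows C W l P'), peelWeight C W g w' (Y.erase y) Y
        = if Y ∩ W ∈ P' (l + 1 - (Y ∩ C).card) then ((Y ∩ C).card : ℚ) * g (Y ∩ C).card (Y ∩ W) else 0 := by
      have hfil : (Y ∩ C).filter (fun y => Y.erase y ∈ stageRows C W l P')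
          = if Y ∩ W ∈ P' (l + 1 - (Y ∩ C).card) then Y ∩ C else ∅ := by
        ext y
        rw [mem_filter, mem_stageRows]
        constructor
        · rintro ⟨hy, _, _, _, hmem⟩
          obtain ⟨hyY, hyC⟩ := mem_inter.1 hy
          have hyW : y ∉ W := fun hyW => (Finset.disjoint_left.1 hCW) hyC hyW
          have h1 : Y.erase y ∩ W = Y ∩ W := by
            rw [erase_inter, erase_eq_of_notMem (fun h => hyW (mem_inter.1 h).2)]
          have h2 : (Y.erase y ∩ C).card = (Y ∩ C).card - 1 := by
            rw [erase_inter, card_erase_of_mem hy]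
          rw [h1, h2] at hmem
          have hpos : 1 ≤ (Y ∩ C).card := card_pos.2 ⟨y, hy⟩
          have : l - ((Y ∩ C).card - 1) = l + 1 - (Y ∩ C).card := by omega
          rw [this] at hmem
          rw [if_pos hmem]; exact hy
        · intro hy
          split_ifs at hy with hmem
          · obtain ⟨hyY, hyC⟩ := mem_inter.1 hy
            have hyW : y ∉ W := fun hyW => (Finset.disjoint_left.1 hCW) hyC hyW
            refine ⟨hy, (erase_subset y Y).trans hYS, ?_, ?_, ?_⟩
            · rw [card_erase_of_mem hyY, hYc]; rfl
            · intro h; exact (notMem_erase y Y) (h hyC)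
            · have h1 : Y.erase y ∩ W = Y ∩ W := by
                rw [erase_inter, erase_eq_of_notMem (fun h => hyW (mem_inter.1 h).2)]
              have h2 : (Y.erase y ∩ C).card = (Y ∩ C).card - 1 := by
                rw [erase_inter, card_erase_of_mem hy]
              have hpos : 1 ≤ (Y ∩ C).card := card_pos.2 ⟨y, hy⟩
              have : l - ((Y ∩ C).card - 1) = l + 1 - (Y ∩ C).card := by omega
              rw [h1, h2, this]; exact hmem
          · exact absurd hy (notMem_empty y)
      rw [hfil]
      split_ifs with hmem
      · have hterm : ∀ y ∈ Y ∩ C, peelWeight C W g w' (Y.erase y) Y = g (Y ∩ C).card (Y ∩ W) := by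
          intro y hy
          have hne : Y ∩ C ≠ Y.erase y ∩ C := by
            rw [erase_inter]; intro h
            have : y ∈ (Y ∩ C).erase y := h ▸ hy
            exact (notMem_erase y (Y ∩ C)) this
          simp only [peelWeight, if_neg hne]
        rw [sum_congr rfl hterm, sum_const, nsmul_eq_mul]
      · exact sum_empty
    -- the rows obtained by removing a point of `W`
    have hW : ∑ y ∈ (Y ∩ W).filter (fun y => Y.erase y ∈ stageRows C W l P'), peelWeight C W g w' (Y.erase y) Y
        = if (Y ∩ C).card < C.card ∧ (Y ∩ C).card ≤ l then ν' (Y ∩ C).card (Y ∩ W) else 0 := by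
      have hCsub : C ⊆ Y ↔ ¬ (Y ∩ C).card < C.card := by
        constructor
        · intro h
          rw [inter_eq_right.2 h]
          exact lt_irrefl _
        · intro h
          have h' : C.card ≤ (Y ∩ C).card := not_lt.1 h
          have : Y ∩ C = C := eq_of_subset_of_card_le inter_subset_right h'
          rw [← this]; exact inter_subset_left
      -- the terms: the inner weight at the `W`-part
      have hterm : ∀ y ∈ Y ∩ W, peelWeight C W g w' (Y.erase y) Y
          = w' (Y ∩ C).card ((Y ∩ W).erase y) (Y ∩ W) := by
        intro y hy
        obtain ⟨hyY, hyW⟩ := mem_inter.1 hy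
        have hyC : y ∉ C := fun hyC => (Finset.disjoint_left.1 hCW) hyC hyW
        have h1 : Y.erase y ∩ C = Y ∩ C := by
          rw [erase_inter, erase_eq_of_notMem (fun h => hyC (mem_inter.1 h).2)]
        have h2 : Y.erase y ∩ W = (Y ∩ W).erase y := erase_inter y Y W
        unfold peelWeight
        rw [if_pos h1.symm, h1, h2]
      -- the filter: the `W`-part minus `y` is an inner row, and `C ⊄ Y`
      have hfil : (Y ∩ W).filter (fun y => Y.erase y ∈ stageRows C W l P')
          = if (Y ∩ C).card < C.card then (Y ∩ W).filter (fun y => (Y ∩ W).erase y ∈ P' (l - (Y ∩ C).card)) else ∅ := by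
        ext y
        rw [mem_filter, mem_stageRows]
        constructor
        · rintro ⟨hy, _, _, hCY, hmem⟩
          obtain ⟨hyY, hyW⟩ := mem_inter.1 hy
          have hyC : y ∉ C := fun hyC => (Finset.disjoint_left.1 hCW) hyC hyW
          have h1 : Y.erase y ∩ C = Y ∩ C := by
            rw [erase_inter, erase_eq_of_notMem (fun h => hyC (mem_inter.1 h).2)]
          have h2 : Y.erase y ∩ W = (Y ∩ W).erase y := erase_inter y Y W
          have hlt : (Y ∩ C).card < C.card := by
            by_contra h
            exact hCY ((subset_erase.2 ⟨hCsub.2 h, hyC⟩))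
          rw [if_pos hlt, mem_filter]
          rw [h1, h2] at hmem
          exact ⟨hy, hmem⟩
        · intro hy
          split_ifs at hy with hlt
          · obtain ⟨hy, hmem⟩ := mem_filter.1 hy
            obtain ⟨hyY, hyW⟩ := mem_inter.1 hy
            have hyC : y ∉ C := fun hyC => (Finset.disjoint_left.1 hCW) hyC hyW
            have h1 : Y.erase y ∩ C = Y ∩ C := by
              rw [erase_inter, erase_eq_of_notMem (fun h => hyC (mem_inter.1 h).2)]
            have h2 : Y.erase y ∩ W = (Y ∩ W).erase y := erase_inter y Y W
            refine ⟨hy, (erase_subset y Y).trans hYS, ?_, ?_, ?_⟩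
            · rw [card_erase_of_mem hyY, hYc]; rfl
            · intro h
              exact (hCsub.1 ((subset_erase.1 h).1)) hlt
            · rw [h1, h2]; exact hmem
          · exact absurd hy (notMem_empty y)
      rw [sum_congr (hfil) (fun y hy => hterm y (by
        split_ifs at hy with hlt
        · exact (mem_filter.1 hy).1
        · exact absurd hy (notMem_empty y)))]
      have hsum : (Y ∩ C).card + (Y ∩ W).card = Y.card := by
        rw [hYsplit, card_union_of_disjoint hdisj, ← hYsplit]
      by_cases hlt : (Y ∩ C).card < C.card
      · by_cases hle : (Y ∩ C).card ≤ l
        · -- `C ⊄ Y` and `t ≤ l`: the inner column sum at `Y ∩ W`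
          rw [if_pos hlt, if_pos ⟨hlt, hle⟩]
          have hYW : Y ∩ W ∈ cols W (l - (Y ∩ C).card) := by
            rw [mem_cols]
            exact ⟨inter_subset_right, by omega⟩
          have hcol := (hflow _ hle hlt).col (Y ∩ W) hYW
          rw [sum_subs_eq (fun X hX => (mem_powersetCard.1 (hP' _ hX)).2) (by omega)] at hcol
          exact hcol
        · -- `C ⊄ Y` but `t = l + 1`: `Y ⊆ C`, no `W`-point to remove
          rw [if_pos hlt, if_neg (fun h => hle h.2)]
          have hempty : Y ∩ W = ∅ := by
            rw [← card_eq_zero]; omega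
          rw [hempty, filter_empty, sum_empty]
      · rw [if_neg hlt, if_neg (fun h => hlt h.1), sum_empty]
    rw [hC, hW]

end PercRepro.PuncturedLYM.Split.Peel
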